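import Literature.Topology.FourManifolds.TrisectionsMiddleSectors
import Mathlib.Geometry.Manifold.BumpFunction
import HarnessLib

/-!
# The middle sectors `X₂`, `X₃` are manifolds with corners exactly along `F`
# (Gay–Kirby 2016, Lemma 14 — the smooth items of clause (ii) of a trisection for `X₂`, `X₃`)

Topic `Literature/Topology/FourManifolds`; infrastructure for the fact seat
`provefact-Literature.Topology.FourManifolds.exists_isBalancedGKTrisection` (Gay–Kirby 2016,
Thm. 4 via Lemma 14).  Everything in this file is **proved**; no named facts are introduced.

The sectors `X₂`, `X₃` of `TrisectionsMiddleSectors.lean` are divided, on the open set of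
points which hit the level `∂X₁⁰`, by the rounded function `M = G + σ_ε((f - c) - G)`
(`BiCollar.TriData.M`).  To straighten their common boundary `{M = 0}` (clause (ii) of
`Literature.Topology.FourManifolds.IsGKTrisection`: the sectors are embedded compact
`4`-manifolds with corners exactly along `F`) one needs `M` to be smooth with nonvanishing
differential along `{M = 0}`.  This file proves it:

* `BiCollar.MorseFrame.contMDiffAt_lamLift`, `contMDiffAt_gFun`, `TriData.contMDiffAt_M` — at
  points which hit, the landing map into the level manifold, the transported Heegaard coordinate
  `G` and `M` are smooth (the landing map `λ` is smooth, Milnor's Assertion 4, and the inclusion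
  of the level is a smooth embedding, Mathlib's `ContMDiffAt.iff_comp_isImmersionAt`);
* `TriData.hasDerivAt_M_fl` — along the trajectory through a point `p` which hits,
  `d/dt M = σ_ε'(w) · ξ(f) ≥ 0`, positive where `w > -ε` (Milnor's `d f(φ(t))/dt = ξ(f)`);
  `TriData.hasDerivAt_M_slide` — along the slide of `TrisectionsMiddleSectors.lean` at a point
  landing on `F` with `w ≤ -ε`, `d/dt M = 1`;
* `Literature.Topology.FourManifolds.not_isMCriticalPt_of_hasDerivAt_comp` — a function with a
  nonzero derivative along some differentiable curve through `p` is not critical at `p` —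
  and `Literature.Topology.FourManifolds.exists_contMDiff_eventuallyEq_of_isOpen` — a function
  smooth on an open set agrees near each of its points with a globally smooth function (smooth
  bump functions, Mathlib's `SmoothBumpFunction`);
* hence **`TriData.exists_contMDiff_eq_M`**: at a point `p` which hits with `M p = 0` there is a
  globally smooth function, equal to `M` near `p`, which is not critical at `p` — the input of
  the straightening charts (`exists_halfSliceChart_of_not_isMCriticalPt'`) of `X₂ = {M ≤ 0}`
  and `X₃ = {M ≥ 0}` near `p` (`mem_X₂_iff_of_hit`, `mem_X₃_iff_of_hit`; `hitChart₂`,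
  `hitChart₃`);
* the other half-slice charts: at the tops of the sheets (`f = c`, the point does not hit)
  `X₂ = {f ≤ c}` and `X₃ = {f ≥ c}` locally (`exists_nhds_top`, from the `λ`-lemma with the
  threshold `b - η`, `η ≥ 2ε`) — `topChart₂`, `topChart₃`; along `∂X₁ ∖ F` (where, below
  `c - 2ε`, the sign of `M` is the sign of `r`, `M_neg_iff_of_mem_band`) `X₂ = {F₁ ≥ 0}` on
  `{r < 0}` and `X₃ = {F₁ ≥ 0}` on `{r > 0}` — `edgeChart₂`, `edgeChart₃`, straightening `Ft`;
  translated interior charts elsewhere (`BiCollar.interiorChart`);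
* **the corner-slice atlases `cornerSliceAtlas₂`, `cornerSliceAtlas₃`** (corner charts of
  `TrisectionsMiddleSectors.lean` at the points of `F`) and the conclusions
  `sector_smooth_clause₂`, `sector_smooth_clause₃`: with the induced charted-space structures
  `X₂`, `X₃` are `C^∞` manifolds with boundary modelled on `𝓡∂ 4`, embedded in `X`, immersed
  off `F`, with corner charts exactly along `F` — the smooth items of clause (ii) of
  `IsGKTrisection` for the middle sectors; and they are compact;
* the boundary points of the straightened `X₂`, `X₃` (`isBoundaryPoint_iff₂`, `isBoundaryPoint_iff₃`)
  and the inclusions `X_i ∩ X_j ⊆ e '' ∂W_i` of clause (ii) for all three sectors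
  (`inter_subset_image_boundary₁`, `₂`, `₃`).

## References

* D. Gay, R. Kirby, *Trisecting 4-manifolds*, Geom. Topol. 20 (2016) 3097–3132
  (arXiv:1205.1565): Def. 1; §4, Lemma 14. [GayKirby2016]
* J. Milnor, *Lectures on the h-cobordism theorem* (1965), proof of Thm. 3.4 (PDF p. 13) and
  proof of Thm. 5.4, Assertion 4 (PDF p. 29). [MilnorHCobordism1965]
-/

open scoped Manifold ContDiff Topology
open Set Function Filter

noncomputable section

universe u

namespace Literature.Topology.FourManifolds

open Flow

variable {X : Type u} [TopologicalSpace X] [T2Space X] [CompactSpace X]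
  [ChartedSpace (EuclideanSpace ℝ (Fin 4)) X] [IsManifold (𝓡 4) ∞ X]

/-! ### Two general lemmas -/

omit [T2Space X] [CompactSpace X] [IsManifold (𝓡 4) ∞ X] in
/-- **A function with a nonzero derivative along a differentiable curve through `p` is not
critical at `p`** (chain rule). [folklore] -/
theorem not_isMCriticalPt_of_hasDerivAt_comp {F : X → ℝ} {p : X}
    (hF : MDifferentiableAt (𝓡 4) 𝓘(ℝ, ℝ) F p) {γ : ℝ → X} (hγ0 : γ 0 = p)
    (hγ : MDifferentiableAt 𝓘(ℝ, ℝ) (𝓡 4) γ 0) {d : ℝ} (hd : HasDerivAt (fun t => F (γ t)) d 0)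
    (hd0 : d ≠ 0) : ¬ IsMCriticalPt (𝓡 4) F p := by
  subst hγ0
  intro hcrit
  have h1 : HasMFDerivAt 𝓘(ℝ, ℝ) 𝓘(ℝ, ℝ) (F ∘ γ) 0
      ((mfderiv (𝓡 4) 𝓘(ℝ, ℝ) F (γ 0)).comp (mfderiv 𝓘(ℝ, ℝ) (𝓡 4) γ 0)) :=
    HasMFDerivAt.comp 0 hF.hasMFDerivAt hγ.hasMFDerivAt
  have hzero : mfderiv (𝓡 4) 𝓘(ℝ, ℝ) F (γ 0) = 0 := hcrit
  rw [hzero, ContinuousLinearMap.zero_comp] at h1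
  have h2 : HasFDerivAt (F ∘ γ) (0 : ℝ →L[ℝ] ℝ) 0 := hasMFDerivAt_iff_hasFDerivAt.1 h1
  have h3 : HasDerivAt (F ∘ γ) 0 0 := by
    have := h2.hasDerivAt
    simpa using this
  exact hd0 (hd.unique h3)

omit [CompactSpace X] in
/-- **A function smooth on an open set agrees near each point of the set with a globally smooth
function** (multiply by a smooth bump function supported in the set). [folklore] -/
theorem exists_contMDiff_eventuallyEq_of_isOpen {g : X → ℝ} {O : Set X} (hO : IsOpen O) {p : X}
    (hp : p ∈ O) (hg : ∀ y ∈ O, ContMDiffAt (𝓡 4) 𝓘(ℝ, ℝ) ∞ g y) :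
    ∃ F : X → ℝ, ContMDiff (𝓡 4) 𝓘(ℝ, ℝ) ∞ F ∧ F =ᶠ[𝓝 p] g := by
  obtain ⟨ψ, -, hψ⟩ := (SmoothBumpFunction.nhds_basis_tsupport (I := 𝓡 4) p).mem_iff.1 (hO.mem_nhds hp)
  refine ⟨fun y => ψ y * g y, ?_, ?_⟩
  · apply contMDiff_of_tsupport
    intro y hy
    have hyO : y ∈ O := hψ (tsupport_mul_subset_left hy)
    exact ψ.contMDiff.contMDiffAt.mul (hg y hyO)
  · filter_upwards [ψ.eventuallyEq_one] with y hy
    simp only [hy, Pi.one_apply, one_mul]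

omit [T2Space X] [CompactSpace X] [IsManifold (𝓡 4) ∞ X] in
/-- A function is critical at a point iff its negative is. [folklore] -/
theorem not_isMCriticalPt_neg {F : X → ℝ} {p : X} (h : ¬ IsMCriticalPt (𝓡 4) F p) :
    ¬ IsMCriticalPt (𝓡 4) (fun y => -F y) p := by
  intro h'
  apply h
  have h'' : mfderiv (𝓡 4) 𝓘(ℝ, ℝ) (-F) p = 0 := h'
  rw [mfderiv_neg] at h''
  show mfderiv (𝓡 4) 𝓘(ℝ, ℝ) F p = 0
  exact neg_eq_zero.1 h''

namespace BiCollar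

variable (B : BiCollar X)

/-- The surface `F` is closed (a continuous image of the compact `F`). [folklore] -/
theorem isClosed_surface : IsClosed B.surface :=
  (isCompact_range ((RegularLevel.isEmbedding_incl B.hf).continuous.comp
    (RegularLevel.isEmbedding_incl B.hg).continuous)).isClosed

/-! ### Smoothness of the landing data at points which hit -/

variable {B} in
/-- **The lifted landing map is smooth at points which hit** (the landing map `λ` is smooth
there and the inclusion of the level is a smooth embedding). [cite: MilnorHCobordism1965, proof of Thm. 5.4, Assertion 4 (PDF p. 29)] -/
theorem MorseFrame.contMDiffAt_lamLift (Fr : B.MorseFrame) {x : X} (hx : B.Hit x) :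
    ContMDiffAt (𝓡 4) (𝓡 3) ∞ B.lamLift x := by
  have hι := RegularLevel.isSmoothEmbedding_incl B.hf
  have hcomp : ContMDiffAt (𝓡 4) (𝓡 4) ∞ (RegularLevel.incl B.hf ∘ B.lamLift) x := by
    refine (Fr.contMDiffAt_lam hx).congr_of_eventuallyEq ?_
    filter_upwards [Fr.isOpen_setOf_hit.mem_nhds hx] with y hy
    exact B.incl_lamLift hy
  have hcont : ContinuousAt B.lamLift x := by
    rw [hι.isEmbedding.isInducing.continuousAt_iff]
    exact hcomp.continuousAt
  exact (ContMDiffAt.iff_comp_isImmersionAt (hι.isImmersion.isImmersionAt _)).2 ⟨hcont, hcomp⟩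

variable {B} in
/-- **`G` is smooth at points which hit.** [cite: GayKirby2016, §4, Lemma 14] -/
theorem MorseFrame.contMDiffAt_gFun (Fr : B.MorseFrame) {x : X} (hx : B.Hit x) :
    ContMDiffAt (𝓡 4) 𝓘(ℝ, ℝ) ∞ B.gFun x :=
  (B.hg.contMDiff.contMDiffAt.comp x (Fr.contMDiffAt_lamLift hx)).sub contMDiffAt_const

/-- The slide is smooth in its time parameter. [folklore] -/
theorem contMDiff_slide (x : X) (τ : ℝ) : ContMDiff 𝓘(ℝ, ℝ) (𝓡 4) ∞ fun t : ℝ => B.slide x τ t := by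
  have h1 : ContMDiff 𝓘(ℝ, ℝ) (𝓡 3) ∞ fun t : ℝ => B.V.fl (B.lamLift x) t :=
    B.V.contMDiff_fl.comp (contMDiff_const.prodMk contMDiff_id)
  unfold BiCollar.slide
  exact B.U.contMDiff_fl.comp (((RegularLevel.contMDiff_incl B.hf).comp h1).prodMk contMDiff_const)

/-- The trajectory through a point is smooth in time. [folklore] -/
theorem contMDiff_fl_right (x : X) : ContMDiff 𝓘(ℝ, ℝ) (𝓡 4) ∞ fun t : ℝ => B.U.fl x t :=
  B.U.contMDiff_fl.comp (contMDiff_const.prodMk contMDiff_id)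

/-- **Milnor's `d f(φ(t))/dt = ξ(f)`** at `t = 0` for the flow of `U`. [cite: MilnorHCobordism1965, proof of Thm. 3.4 (PDF p. 13)] -/
theorem hasDerivAt_f_fl (p : X) :
    HasDerivAt (fun t => B.f (B.U.fl p t)) (mlineDeriv (𝓡 4) B.f p (B.U.ξ p)) 0 := by
  have hf : MDifferentiable (𝓡 4) 𝓘(ℝ, ℝ) B.f := B.U.contMDiff_f.mdifferentiable (by simp)
  have h := (isSmoothFlow_flow B.U.contMDiff).hasDerivAt_comp hf p 0
  simp only at h
  rw [flow_zero] at h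
  exact h

namespace TriData

variable {B} (T : B.TriData)

/-- `w` is smooth at points which hit. [folklore] -/
theorem contMDiffAt_w {x : X} (hx : B.Hit x) : ContMDiffAt (𝓡 4) 𝓘(ℝ, ℝ) ∞ T.w x :=
  (B.U.contMDiff_f.contMDiffAt.sub contMDiffAt_const).sub (T.Fr.contMDiffAt_gFun hx)

/-- **`M` is smooth at points which hit.** [cite: GayKirby2016, §4, Lemma 14] -/
theorem contMDiffAt_M {x : X} (hx : B.Hit x) : ContMDiffAt (𝓡 4) 𝓘(ℝ, ℝ) ∞ T.M x :=
  (T.Fr.contMDiffAt_gFun hx).add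
    ((contDiff_creaseσ T.ε).contMDiff.contMDiffAt.comp x (T.contMDiffAt_w hx))

/-- `M` is continuous at points which hit. [folklore] -/
theorem continuousAt_M {x : X} (hx : B.Hit x) : ContinuousAt T.M x := (T.contMDiffAt_M hx).continuousAt

/-! ### The derivative of `M` along the flow and along the slide -/

/-- **Along the trajectory through a point which hits, `d/dt M = σ_ε'(w) · ξ(f)`** (`G` is
constant along trajectories). [cite: GayKirby2016, §4, Lemma 14; MilnorHCobordism1965, proof of Thm. 3.4] -/
theorem hasDerivAt_M_fl {p : X} (hp : B.Hit p) :
    HasDerivAt (fun t => T.M (B.U.fl p t))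
      (creaseStep (T.w p / T.ε) * mlineDeriv (𝓡 4) B.f p (B.U.ξ p)) 0 := by
  have h1 := B.hasDerivAt_f_fl p
  have h2 : HasDerivAt (fun t => B.f (B.U.fl p t) - T.c - B.gFun p)
      (mlineDeriv (𝓡 4) B.f p (B.U.ξ p)) 0 := (h1.sub_const _).sub_const _
  have h3 := ((hasDerivAt_creaseσ T.ε_pos _).comp (0 : ℝ) h2).const_add (B.gFun p)
  have hfun : (fun t => T.M (B.U.fl p t)) =
      fun t => B.gFun p + creaseσ T.ε (B.f (B.U.fl p t) - T.c - B.gFun p) := by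
    funext t
    rw [TriData.M, T.w_fl hp t, T.Fr.gFun_fl hp t]
  rw [hfun]
  have hw : B.f (B.U.fl p 0) - T.c - B.gFun p = T.w p := by rw [B.U.fl_zero]; rfl
  rw [hw] at h3
  exact h3

/-- **Along the slide at a point landing on `F` with `w ≤ -ε`, `d/dt M = 1`** (`G = t` exactly by
the clock of `V`, and `σ_ε'(w) = 0`). [cite: GayKirby2016, §4, Lemma 14] -/
theorem hasDerivAt_M_slide {x : X} (hx : B.Hit x) (hG : B.gFun x = 0) (hw : T.w x ≤ -T.ε) {τ : ℝ}
    (hτ : B.U.fl (B.lam x) τ = x) : HasDerivAt (fun t => T.M (B.slide x τ t)) 1 0 := by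
  have hs0 : B.slide x τ 0 = x := B.slide_zero hx hτ
  set u : ℝ → ℝ := fun t => B.f (B.slide x τ t) - T.c - t with hu
  have hu0 : u 0 = T.w x := by
    simp only [hu, hs0, sub_zero]
    rw [w, hG, sub_zero]
  obtain ⟨d, hd⟩ : ∃ d, HasDerivAt u d 0 :=
    ⟨_, ((B.hasDerivAt_f_slide x τ 0).sub_const T.c).sub (hasDerivAt_id' (0 : ℝ))⟩
  have hψ : HasDerivAt (fun t => creaseσ T.ε (u t)) 0 0 := by
    have h := (hasDerivAt_creaseσ T.ε_pos (u 0)).comp (0 : ℝ) hd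
    have hz : creaseStep (u 0 / T.ε) = 0 := by
      rw [hu0]
      exact creaseStep_of_le_neg_one (by rw [div_le_iff₀ T.ε_pos]; linarith)
    rw [hz, zero_mul] at h
    exact h
  have hφ' : HasDerivAt (fun t => t + creaseσ T.ε (u t)) 1 0 := by
    have h := (hasDerivAt_id' (0 : ℝ)).add hψ
    rw [add_zero] at h
    exact h
  have hMφ : (fun t => T.M (B.slide x τ t)) =ᶠ[𝓝 0] fun t => t + creaseσ T.ε (u t) := by
    have hI : Ioo (-B.V.δ) B.V.δ ∈ 𝓝 (0 : ℝ) := Ioo_mem_nhds (by linarith [B.V.δ_pos]) B.V.δ_pos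
    filter_upwards [hI] with t ht
    have hGt : B.gFun (B.slide x τ t) = t := T.Fr.gFun_slide hG τ ht
    show B.gFun (B.slide x τ t) + creaseσ T.ε (T.w (B.slide x τ t)) = t + creaseσ T.ε (u t)
    rw [w, hGt]
  exact hφ'.congr_of_eventuallyEq hMφ

/-! ### Regularity of `M` along `{M = 0}` -/

/-- **At a point which hits with `M = 0` (and `f ≤ c`), some globally smooth function equal
to `M` near the point is not critical there.**  If `w > -ε` the derivative of `M` along the
trajectory is `σ_ε'(w) ξ(f) > 0`; if `w ≤ -ε` the point lands on `F` and the derivative of `M`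
along the slide is `1`. [cite: GayKirby2016, §4, Lemma 14] -/
theorem exists_contMDiff_eq_M {p : X} (hp : B.Hit p) (h0 : T.M p = 0) :
    ∃ F : X → ℝ, ContMDiff (𝓡 4) 𝓘(ℝ, ℝ) ∞ F ∧ F =ᶠ[𝓝 p] T.M ∧ ¬ IsMCriticalPt (𝓡 4) F p := by
  obtain ⟨F, hF, hFM⟩ := exists_contMDiff_eventuallyEq_of_isOpen T.Fr.isOpen_setOf_hit hp
    (fun y hy => T.contMDiffAt_M hy)
  refine ⟨F, hF, hFM, ?_⟩
  have hFd : MDifferentiableAt (𝓡 4) 𝓘(ℝ, ℝ) F p := hF.contMDiffAt.mdifferentiableAt (by simp)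
  rcases lt_or_ge (-T.ε) (T.w p) with hw | hw
  · -- along the trajectory
    have hγ : MDifferentiableAt 𝓘(ℝ, ℝ) (𝓡 4) (fun t : ℝ => B.U.fl p t) 0 :=
      (B.contMDiff_fl_right p).contMDiffAt.mdifferentiableAt (by simp)
    have hcurve : HasDerivAt (fun t => F (B.U.fl p t))
        (creaseStep (T.w p / T.ε) * mlineDeriv (𝓡 4) B.f p (B.U.ξ p)) 0 := by
      refine (T.hasDerivAt_M_fl hp).congr_of_eventuallyEq ?_
      have hc : ContinuousAt (fun t : ℝ => B.U.fl p t) 0 := (B.contMDiff_fl_right p).continuous.continuousAt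
      have hp0 : B.U.fl p 0 = p := B.U.fl_zero p
      have h := hc.eventually (show ∀ᶠ y in 𝓝 (B.U.fl p 0), F y = T.M y by rw [hp0]; exact hFM)
      filter_upwards [h] with t ht
      exact ht
    refine not_isMCriticalPt_of_hasDerivAt_comp hFd (B.U.fl_zero p) hγ hcurve (ne_of_gt ?_)
    refine mul_pos (creaseStep_pos (by rw [lt_div_iff₀ T.ε_pos]; linarith)) ?_
    exact IsGradientLike.mlineDeriv_pos T.Fr.isGradientLike p (T.Fr.not_isMCriticalPt_of_hit hp)
  · -- along the slide
    have hG : B.gFun p = 0 := T.gFun_eq_zero_of_M_eq_zero h0 hw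
    obtain ⟨τ, hτ⟩ : ∃ τ, B.U.fl (B.lam p) τ = p := mem_range_flow_levelProj B.U.contMDiff B.a p
    have hs0 : B.slide p τ 0 = p := B.slide_zero hp hτ
    have hγ : MDifferentiableAt 𝓘(ℝ, ℝ) (𝓡 4) (fun t : ℝ => B.slide p τ t) 0 :=
      (B.contMDiff_slide p τ).contMDiffAt.mdifferentiableAt (by simp)
    have hcurve : HasDerivAt (fun t => F (B.slide p τ t)) 1 0 := by
      refine (T.hasDerivAt_M_slide hp hG hw hτ).congr_of_eventuallyEq ?_
      have hc : ContinuousAt (fun t : ℝ => B.slide p τ t) 0 := (B.contMDiff_slide p τ).continuous.continuousAt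
      have h := hc.eventually (show ∀ᶠ y in 𝓝 (B.slide p τ 0), F y = T.M y by rw [hs0]; exact hFM)
      filter_upwards [h] with t ht
      exact ht
    exact not_isMCriticalPt_of_hasDerivAt_comp hFd hs0 hγ hcurve one_ne_zero


/-! ### `X₂ = {M ≤ 0}` and `X₃ = {M ≥ 0}` near points which hit -/

/-- **A point outside `X₁` with `f ≤ c` which hits and has `M = 0` is in the closure of `S₂`**
(the case `f = c` — the rounded top lid and the tops over `{G ≤ -ε}` —: there `w > -ε`, and
the backward flow lowers `f` strictly below `c` and `M` strictly below `0`).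
[cite: GayKirby2016, §4, Lemma 14] -/
theorem mem_closure_S₂_of_M_eq_zero_of_le {x : X} (hx₁ : x ∉ T.X₁) (hxc : B.f x ≤ T.c) (hx : B.Hit x)
    (h0 : T.M x = 0) : x ∈ closure T.S₂ := by
  rcases hxc.lt_or_eq with hlt | heq
  · exact T.mem_closure_S₂_of_M_eq_zero hx₁ hlt hx h0
  · have hw : -T.ε < T.w x := by
      by_contra h
      have hG := T.gFun_eq_zero_of_M_eq_zero h0 (not_lt.1 h)
      have hw0 : T.w x = 0 := by rw [TriData.w, heq, hG]; ring
      linarith [T.ε_pos, not_lt.1 h]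
    have hcont := B.tendsto_fl_neg x
    apply mem_closure_of_tendsto hcont
    have h1 : ∀ᶠ t : ℝ in 𝓝[>] 0, B.U.fl x (-t) ∈ T.X₁ᶜ := hcont (T.isClosed_X₁.isOpen_compl.mem_nhds hx₁)
    have hwx : T.w x = B.f x - T.c - B.gFun x := rfl
    have h3 : ∀ᶠ t : ℝ in 𝓝[>] 0, B.U.fl x (-t) ∈ {y | T.c + B.gFun x - T.ε < B.f y} :=
      hcont ((isOpen_lt continuous_const B.U.contMDiff_f.continuous).mem_nhds
        (by show T.c + B.gFun x - T.ε < B.f x; linarith))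
    filter_upwards [h1, h3, self_mem_nhdsWithin] with t ht1 ht3 ht0
    have ht0 : 0 < t := ht0
    have ht3 : T.c + B.gFun x - T.ε < B.f (B.U.fl x (-t)) := ht3
    have hflt : B.f (B.U.fl x (-t)) < B.f x := T.Fr.f_fl_lt_of_pos hx ht0
    refine ⟨ht1, by show B.f (B.U.fl x (-t)) < T.c; linarith, B.hit_fl hx (-t), ?_⟩
    have hwt : T.w (B.U.fl x (-t)) = B.f (B.U.fl x (-t)) - T.c - B.gFun x := T.w_fl hx (-t)
    have hwlt : T.w (B.U.fl x (-t)) < T.w x := by rw [hwt, hwx]; linarith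
    have hwge : -T.ε ≤ T.w (B.U.fl x (-t)) := by rw [hwt]; linarith
    have hσ := strictMonoOn_creaseσ T.ε_pos hwge hw.le hwlt
    have hM : B.gFun x + creaseσ T.ε (T.w x) = 0 := h0
    show B.gFun (B.U.fl x (-t)) + creaseσ T.ε (T.w (B.U.fl x (-t))) < 0
    rw [T.Fr.gFun_fl hx]
    linarith

/-- At a point which hits, `X₂ ⊆ {M ≤ 0}`. [cite: GayKirby2016, §4, Lemma 14] -/
theorem M_nonpos_of_mem_X₂ {y : X} (hy : B.Hit y) (h : y ∈ T.X₂) : T.M y ≤ 0 := by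
  rcases h with hcl | hsh
  · have h := nonneg_of_mem_closure (φ := fun z => -T.M z) (T.continuousAt_M hy).neg hcl
      (fun z hz => by have := hz.2.2.2; show 0 ≤ -T.M z; linarith)
    have h' : 0 ≤ -T.M y := h
    linarith
  · exact absurd hy hsh.2.2

/-- At a point which hits, `X₃ ⊆ {M ≥ 0}`. [cite: GayKirby2016, §4, Lemma 14] -/
theorem M_nonneg_of_mem_X₃ {y : X} (hy : B.Hit y) (h : y ∈ T.X₃) : 0 ≤ T.M y := by
  rcases h with hcl | hge
  · exact nonneg_of_mem_closure (φ := T.M) (T.continuousAt_M hy) hcl (fun z hz => hz.2.2.le)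
  · have := T.sub_le_M y
    have hge : T.c ≤ B.f y := hge
    linarith

/-- **At a point which hits, outside `X₁`: `y ∈ X₂ ↔ M y ≤ 0`.** [cite: GayKirby2016, §4, Lemma 14] -/
theorem mem_X₂_iff_of_hit {y : X} (hy : B.Hit y) (hy₁ : y ∉ T.X₁) : y ∈ T.X₂ ↔ T.M y ≤ 0 := by
  refine ⟨T.M_nonpos_of_mem_X₂ hy, fun h => ?_⟩
  have hfc : B.f y - T.c ≤ T.M y := T.sub_le_M y
  rcases h.lt_or_eq with hlt | h0
  · exact T.S₂_subset_X₂ ⟨hy₁, by linarith, hy, hlt⟩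
  · exact T.closure_S₂_subset_X₂ (T.mem_closure_S₂_of_M_eq_zero_of_le hy₁ (by linarith) hy h0)

/-- **At a point which hits, outside `X₁`: `y ∈ X₃ ↔ 0 ≤ M y`.** [cite: GayKirby2016, §4, Lemma 14] -/
theorem mem_X₃_iff_of_hit {y : X} (hy : B.Hit y) (hy₁ : y ∉ T.X₁) : y ∈ T.X₃ ↔ 0 ≤ T.M y := by
  refine ⟨T.M_nonneg_of_mem_X₃ hy, fun h => ?_⟩
  rcases h.lt_or_eq with hlt | h0
  · exact T.S₃_subset_X₃ ⟨hy₁, hy, hlt⟩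
  · exact Or.inl (T.mem_closure_S₃_of_M_eq_zero hy₁ hy h0.symm)

/-! ### The straightening charts of `X₂` and `X₃` at boundary points which hit -/

/-- The straightening function at a boundary point which hits: a globally smooth function equal
to `M` near the point and not critical there (`exists_contMDiff_eq_M`). [folklore] -/
def strFun {p : X} (hp : B.Hit p) (h0 : T.M p = 0) : X → ℝ :=
  Classical.choose (T.exists_contMDiff_eq_M hp h0)

/-- The straightening function is smooth. [folklore] -/
theorem contMDiff_strFun {p : X} (hp : B.Hit p) (h0 : T.M p = 0) :
    ContMDiff (𝓡 4) 𝓘(ℝ, ℝ) ∞ (T.strFun hp h0) :=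
  (Classical.choose_spec (T.exists_contMDiff_eq_M hp h0)).1

/-- The straightening function is `M` near the point. [folklore] -/
theorem strFun_eventuallyEq {p : X} (hp : B.Hit p) (h0 : T.M p = 0) : T.strFun hp h0 =ᶠ[𝓝 p] T.M :=
  (Classical.choose_spec (T.exists_contMDiff_eq_M hp h0)).2.1

/-- The straightening function is not critical at the point. [folklore] -/
theorem not_isMCriticalPt_strFun {p : X} (hp : B.Hit p) (h0 : T.M p = 0) :
    ¬ IsMCriticalPt (𝓡 4) (T.strFun hp h0) p :=
  (Classical.choose_spec (T.exists_contMDiff_eq_M hp h0)).2.2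

/-- Nor is its negative. [folklore] -/
theorem not_isMCriticalPt_neg_strFun {p : X} (hp : B.Hit p) (h0 : T.M p = 0) :
    ¬ IsMCriticalPt (𝓡 4) (fun y => -T.strFun hp h0 y) p :=
  not_isMCriticalPt_neg (T.not_isMCriticalPt_strFun hp h0)

/-- The domain on which `X₂`/`X₃` are read through the straightening function: points which hit,
outside `X₁`, where the function is `M`. [folklore] -/
def strDom {p : X} (hp : B.Hit p) (h0 : T.M p = 0) : Set X :=
  ({y | B.Hit y} ∩ T.X₁ᶜ) ∩ interior {y | T.strFun hp h0 y = T.M y}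

/-- The domain is open. [folklore] -/
theorem isOpen_strDom {p : X} (hp : B.Hit p) (h0 : T.M p = 0) : IsOpen (T.strDom hp h0) :=
  (T.Fr.isOpen_setOf_hit.inter T.isClosed_X₁.isOpen_compl).inter isOpen_interior

/-- The point lies in the domain. [folklore] -/
theorem mem_strDom {p : X} (hp : B.Hit p) (h0 : T.M p = 0) (hp₁ : p ∉ T.X₁) : p ∈ T.strDom hp h0 :=
  ⟨⟨hp, hp₁⟩, mem_interior_iff_mem_nhds.2 (T.strFun_eventuallyEq hp h0)⟩

/-- The domain avoids the surface `F` (which lies in `X₁`). [folklore] -/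
theorem not_mem_surface_of_mem_strDom {p : X} (hp : B.Hit p) (h0 : T.M p = 0) {q : X}
    (hq : q ∈ T.strDom hp h0) : q ∉ B.surface := fun h => hq.1.2 (T.D.surface_subset_sector h)

/-- **The half-slice chart of `X₂` at a boundary point which hits** (`M p = 0`, `p ∉ X₁`): the
straightening chart of the straightening function (`exists_halfSliceChart_of_not_isMCriticalPt'`)
read on the domain where `X₂ = {M ≤ 0}`. [cite: GayKirby2016, Def. 1; Milnor1963, Thm. 3.1] -/
def hitChart₂ {p : X} (hp : B.Hit p) (h0 : T.M p = 0) : HalfSliceChart (𝓡 4) T.X₂ :=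
  (Classical.choose (exists_halfSliceChart_of_not_isMCriticalPt' (T.contMDiff_strFun hp h0) 0
    (T.not_isMCriticalPt_strFun hp h0))).restrCongr (T.strDom hp h0) (T.isOpen_strDom hp h0)
    (fun q hq => by
      have hF : T.strFun hp h0 q = T.M q := interior_subset (s := {y | T.strFun hp h0 y = T.M y}) hq.2
      rw [T.mem_X₂_iff_of_hit hq.1.1 hq.1.2, mem_preimage, mem_Iic, hF])

/-- The point lies in the source of its chart. [folklore] -/
theorem mem_hitChart₂_source {p : X} (hp : B.Hit p) (h0 : T.M p = 0) (hp₁ : p ∉ T.X₁) :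
    p ∈ (T.hitChart₂ hp h0).Θ.source :=
  ⟨(Classical.choose_spec (exists_halfSliceChart_of_not_isMCriticalPt' (T.contMDiff_strFun hp h0) 0
    (T.not_isMCriticalPt_strFun hp h0))).1, T.mem_strDom hp h0 hp₁⟩

/-- The source of the chart avoids the surface. [folklore] -/
theorem not_mem_surface_of_mem_hitChart₂_source {p : X} (hp : B.Hit p) (h0 : T.M p = 0) {q : X}
    (hq : q ∈ (T.hitChart₂ hp h0).Θ.source) : q ∉ B.surface :=
  T.not_mem_surface_of_mem_strDom hp h0 hq.2

/-- **The half-slice chart of `X₃` at a boundary point which hits**: the straightening chart of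
the negative of the straightening function, read on the domain where `X₃ = {M ≥ 0}`.
[cite: GayKirby2016, Def. 1; Milnor1963, Thm. 3.1] -/
def hitChart₃ {p : X} (hp : B.Hit p) (h0 : T.M p = 0) : HalfSliceChart (𝓡 4) T.X₃ :=
  (Classical.choose (exists_halfSliceChart_of_not_isMCriticalPt' ((T.contMDiff_strFun hp h0).neg) 0
    (T.not_isMCriticalPt_neg_strFun hp h0))).restrCongr (T.strDom hp h0) (T.isOpen_strDom hp h0)
    (fun q hq => by
      have hF : T.strFun hp h0 q = T.M q := interior_subset (s := {y | T.strFun hp h0 y = T.M y}) hq.2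
      rw [T.mem_X₃_iff_of_hit hq.1.1 hq.1.2, mem_preimage, mem_Iic, hF, neg_nonpos])

/-- The point lies in the source of its chart. [folklore] -/
theorem mem_hitChart₃_source {p : X} (hp : B.Hit p) (h0 : T.M p = 0) (hp₁ : p ∉ T.X₁) :
    p ∈ (T.hitChart₃ hp h0).Θ.source :=
  ⟨(Classical.choose_spec (exists_halfSliceChart_of_not_isMCriticalPt' ((T.contMDiff_strFun hp h0).neg) 0
    (T.not_isMCriticalPt_neg_strFun hp h0))).1, T.mem_strDom hp h0 hp₁⟩

/-- The source of the chart avoids the surface. [folklore] -/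
theorem not_mem_surface_of_mem_hitChart₃_source {p : X} (hp : B.Hit p) (h0 : T.M p = 0) {q : X}
    (hq : q ∈ (T.hitChart₃ hp h0).Θ.source) : q ∉ B.surface :=
  T.not_mem_surface_of_mem_strDom hp h0 hq.2


/-! ### The charts at the tops of the sheets -/

/-- `X₂ ⊆ {f ≤ c}`. [folklore] -/
theorem f_le_c_of_mem_X₂ {y : X} (hy : y ∈ T.X₂) : B.f y ≤ T.c := by
  rcases hy with hcl | hsh
  · exact closure_lt_subset_le B.U.contMDiff_f.continuous continuous_const
      (closure_mono (fun z hz => hz.2.1) hcl)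
  · exact hsh.2.1

/-- **Near the top of a sheet, `X₂ = {f ≤ c}` and `X₃ = {f ≥ c}`.**  With the `λ`-lemma for the
threshold `b - η`, `η ≥ 2ε`: near a sheet point with `f = c`, points which hit have `G < -η`,
hence `w ≥ ε` and `M = f - c`. [cite: GayKirby2016, §4, Lemma 14] -/
theorem exists_nhds_top {η : ℝ} (hη : 2 * T.ε ≤ η)
    (hL : ∀ q : X, IsMCriticalPt (𝓡 4) B.f q → B.a < B.f q → B.f q ≤ T.c →
      ∀ y : B.Y, RegularLevel.incl B.hf y ∈ stableSet (𝓡 4) B.U.ξ q → B.g y < B.b - η)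
    {p : X} (hp : p ∈ T.sheets) (hp₁ : p ∉ T.X₁) (hpc : B.f p = T.c) :
    ∃ N : Set X, IsOpen N ∧ p ∈ N ∧ (∀ y ∈ N, y ∉ B.surface) ∧
      (∀ y ∈ N, y ∈ T.X₂ ↔ B.f y ≤ T.c) ∧ (∀ y ∈ N, y ∈ T.X₃ ↔ T.c ≤ B.f y) := by
  have h1 : ∀ᶠ y in 𝓝 p, y ∉ T.X₁ := T.isClosed_X₁.isOpen_compl.mem_nhds hp₁
  have h2 : ∀ᶠ y in 𝓝 p, T.c - T.ε < B.f y :=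
    (isOpen_lt continuous_const B.U.contMDiff_f.continuous).mem_nhds
      (by show T.c - T.ε < B.f p; rw [hpc]; linarith [T.ε_pos])
  have h3 := T.eventually_g_lamLift_lt_of_mem_sheets hL hp
  obtain ⟨N, hN, hNo, hpN⟩ := eventually_nhds_iff.1 (h1.and (h2.and h3))
  -- on `N`, points which hit have `M = f - c`
  have hM : ∀ y ∈ N, B.Hit y → T.M y = B.f y - T.c := fun y hy hh => by
    obtain ⟨-, hy2, hy3⟩ := hN y hy
    have hG : B.gFun y < -η := by
      have := hy3 hh; show B.g (B.lamLift y) - B.b < -η; linarith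
    apply T.M_eq_sub_of_le_w
    show T.ε ≤ B.f y - T.c - B.gFun y
    linarith
  refine ⟨N, hNo, hpN, fun y hy hs => (hN y hy).1 (T.D.surface_subset_sector hs), fun y hy => ?_, fun y hy => ?_⟩
  · refine ⟨T.f_le_c_of_mem_X₂, fun hyc => ?_⟩
    by_cases hh : B.Hit y
    · rw [T.mem_X₂_iff_of_hit hh (hN y hy).1, hM y hy hh]; linarith
    · exact T.sheets_subset_X₂ ⟨T.a_le_of_not_mem_X₁_of_not_hit (hN y hy).1 hh, hyc, hh⟩
  · refine ⟨fun h => ?_, T.mem_X₃_of_le⟩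
    rcases h with hcl | hge
    · -- `closure S₃ ∩ N ⊆ closure (S₃ ∩ N) ⊆ closure {c < f} ⊆ {c ≤ f}`
      have hcl' : y ∈ closure (N ∩ T.S₃) := hNo.inter_closure ⟨hy, hcl⟩
      refine closure_lt_subset_le continuous_const B.U.contMDiff_f.continuous (closure_mono ?_ hcl')
      rintro z ⟨hzN, hzS⟩
      have := hM z hzN hzS.2.1
      show T.c < B.f z
      linarith [hzS.2.2]
    · exact hge

section TopCharts

variable {η : ℝ} (hη : 2 * T.ε ≤ η)
  (hL : ∀ q : X, IsMCriticalPt (𝓡 4) B.f q → B.a < B.f q → B.f q ≤ T.c →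
    ∀ y : B.Y, RegularLevel.incl B.hf y ∈ stableSet (𝓡 4) B.U.ξ q → B.g y < B.b - η)

/-- The neighbourhood of a sheet top on which `X₂ = {f ≤ c}`, `X₃ = {f ≥ c}`. [folklore] -/
def topDom {p : X} (hp : p ∈ T.sheets) (hp₁ : p ∉ T.X₁) (hpc : B.f p = T.c) : Set X :=
  Classical.choose (T.exists_nhds_top hη hL hp hp₁ hpc)

/-- **The half-slice chart of `X₂` at the top of a sheet**: the straightening chart of `f` at the
level `c`. [cite: GayKirby2016, §4, Lemma 14; Milnor1963, Thm. 3.1] -/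
def topChart₂ {p : X} (hp : p ∈ T.sheets) (hp₁ : p ∉ T.X₁) (hpc : B.f p = T.c) :
    HalfSliceChart (𝓡 4) T.X₂ :=
  (Classical.choose (exists_halfSliceChart_of_not_isMCriticalPt' B.U.contMDiff_f T.c
    (T.regular_c p hpc))).restrCongr (T.topDom hη hL hp hp₁ hpc)
    (Classical.choose_spec (T.exists_nhds_top hη hL hp hp₁ hpc)).1
    (fun q hq => by
      rw [(Classical.choose_spec (T.exists_nhds_top hη hL hp hp₁ hpc)).2.2.2.1 q hq, mem_preimage, mem_Iic])

/-- The point lies in the source of its chart. [folklore] -/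
theorem mem_topChart₂_source {p : X} (hp : p ∈ T.sheets) (hp₁ : p ∉ T.X₁) (hpc : B.f p = T.c) :
    p ∈ (T.topChart₂ hη hL hp hp₁ hpc).Θ.source :=
  ⟨(Classical.choose_spec (exists_halfSliceChart_of_not_isMCriticalPt' B.U.contMDiff_f T.c
    (T.regular_c p hpc))).1, (Classical.choose_spec (T.exists_nhds_top hη hL hp hp₁ hpc)).2.1⟩

/-- The source of the chart avoids the surface. [folklore] -/
theorem not_mem_surface_of_mem_topChart₂_source {p : X} (hp : p ∈ T.sheets) (hp₁ : p ∉ T.X₁)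
    (hpc : B.f p = T.c) {q : X} (hq : q ∈ (T.topChart₂ hη hL hp hp₁ hpc).Θ.source) : q ∉ B.surface :=
  (Classical.choose_spec (T.exists_nhds_top hη hL hp hp₁ hpc)).2.2.1 q hq.2

/-- **The half-slice chart of `X₃` at the top of a sheet**: the straightening chart of `-f` at
the level `-c`. [cite: GayKirby2016, §4, Lemma 14; Milnor1963, Thm. 3.1] -/
def topChart₃ {p : X} (hp : p ∈ T.sheets) (hp₁ : p ∉ T.X₁) (hpc : B.f p = T.c) :
    HalfSliceChart (𝓡 4) T.X₃ :=
  (Classical.choose (exists_halfSliceChart_of_not_isMCriticalPt' B.U.contMDiff_f.neg (-T.c)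
    (not_isMCriticalPt_neg (T.regular_c p hpc)))).restrCongr (T.topDom hη hL hp hp₁ hpc)
    (Classical.choose_spec (T.exists_nhds_top hη hL hp hp₁ hpc)).1
    (fun q hq => by
      rw [(Classical.choose_spec (T.exists_nhds_top hη hL hp hp₁ hpc)).2.2.2.2 q hq, mem_preimage, mem_Iic,
        neg_le_neg_iff])

/-- The point lies in the source of its chart. [folklore] -/
theorem mem_topChart₃_source {p : X} (hp : p ∈ T.sheets) (hp₁ : p ∉ T.X₁) (hpc : B.f p = T.c) :
    p ∈ (T.topChart₃ hη hL hp hp₁ hpc).Θ.source :=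
  ⟨(Classical.choose_spec (exists_halfSliceChart_of_not_isMCriticalPt' B.U.contMDiff_f.neg (-T.c)
    (not_isMCriticalPt_neg (T.regular_c p hpc)))).1,
    (Classical.choose_spec (T.exists_nhds_top hη hL hp hp₁ hpc)).2.1⟩

/-- The source of the chart avoids the surface. [folklore] -/
theorem not_mem_surface_of_mem_topChart₃_source {p : X} (hp : p ∈ T.sheets) (hp₁ : p ∉ T.X₁)
    (hpc : B.f p = T.c) {q : X} (hq : q ∈ (T.topChart₃ hη hL hp hp₁ hpc).Θ.source) : q ∉ B.surface :=
  (Classical.choose_spec (T.exists_nhds_top hη hL hp hp₁ hpc)).2.2.1 q hq.2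

end TopCharts

/-! ### The charts along `∂X₁ ∖ F` -/

/-- **On the band of `U` (below `c - 2ε`), the sign of `M` is the sign of `r`**: if `r ≥ -ε`
then `w ≤ -ε` and `M = G = r`; if `r < -ε` then `M ≤ max(r, f - c) + ε < 0`.
[cite: GayKirby2016, §4, Lemma 14] -/
theorem M_eq_rFun_or_of_mem_band (hc2 : B.a + B.U.δ + 2 * T.ε ≤ T.c) {y : X} (hy : y ∈ B.U.band) :
    T.M y = B.rFun y ∨ (T.M y < 0 ∧ B.rFun y < -T.ε) := by
  have hG : B.gFun y = B.rFun y := T.Fr.gFun_eq_rFun hy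
  have hf : B.f y < B.a + B.U.δ := (B.U.mem_band_iff.1 hy).2
  have hε := T.ε_pos
  rcases le_or_gt (-T.ε) (B.rFun y) with hr | hr
  · left
    rw [T.M_eq_gFun_of_w_le (by show B.f y - T.c - B.gFun y ≤ -T.ε; rw [hG]; linarith), hG]
  · right
    refine ⟨?_, hr⟩
    have h := T.M_le y
    rw [hG] at h
    have hmax : max (B.rFun y) (B.f y - T.c) < -T.ε := max_lt hr (by linarith)
    linarith

/-- On the band, `M < 0 ↔ r < 0`. [cite: GayKirby2016, §4, Lemma 14] -/
theorem M_neg_iff_of_mem_band (hc2 : B.a + B.U.δ + 2 * T.ε ≤ T.c) {y : X} (hy : y ∈ B.U.band) :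
    T.M y < 0 ↔ B.rFun y < 0 := by
  rcases T.M_eq_rFun_or_of_mem_band hc2 hy with h | h
  · rw [h]
  · exact ⟨fun _ => by linarith [h.2, T.ε_pos], fun _ => h.1⟩

/-- On the band, `0 < M ↔ 0 < r`. [cite: GayKirby2016, §4, Lemma 14] -/
theorem M_pos_iff_of_mem_band (hc2 : B.a + B.U.δ + 2 * T.ε ≤ T.c) {y : X} (hy : y ∈ B.U.band) :
    0 < T.M y ↔ 0 < B.rFun y := by
  rcases T.M_eq_rFun_or_of_mem_band hc2 hy with h | h
  · rw [h]
  · exact ⟨fun h' => by linarith [h.1], fun h' => by linarith [h.2, T.ε_pos]⟩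

/-- On the band, `M ≤ 0 ↔ r ≤ 0`. [cite: GayKirby2016, §4, Lemma 14] -/
theorem M_nonpos_iff_of_mem_band (hc2 : B.a + B.U.δ + 2 * T.ε ≤ T.c) {y : X} (hy : y ∈ B.U.band) :
    T.M y ≤ 0 ↔ B.rFun y ≤ 0 := by
  rw [← not_lt, ← not_lt, T.M_pos_iff_of_mem_band hc2 hy]

/-- `X₂ ⊆ {F₁ ≥ 0}` (the generic part lies outside `X₁ = {F₁ ≤ 0}`, and on the sheets
`s ≥ δ_U > 0`). [folklore] -/
theorem F₁_nonneg_of_mem_X₂ {y : X} (hy : y ∈ T.X₂) : 0 ≤ T.D.F₁ y := by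
  rcases hy with hcl | hsh
  · refine closure_lt_subset_le continuous_const T.D.continuous_F₁ (closure_mono (fun z hz => ?_) hcl)
    exact not_le.1 (fun h => hz.1 (T.D.mem_sector_iff.2 h))
  · -- a sheet point is not in the band, and `f ≥ a`: `s ≥ δ_U`
    have hs : B.U.δ ≤ B.sFun y := by
      by_contra h
      have h' : B.sFun y < B.U.δ := not_le.1 h
      have h1 : B.a ≤ B.f y := hsh.1
      have h2 : B.f y = B.a + B.sFun y := B.f_eq_add_sFun y
      exact hsh.2.2 (B.hit_of_mem_band (by
        rw [LevelUnitField.mem_band_iff]; exact ⟨by linarith [B.U.δ_pos], by linarith⟩))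
    have hθ := T.D.θ_nonneg y
    have hκ := T.D.κ_pos
    show 0 ≤ B.sFun y + T.D.κ * T.D.θ y
    nlinarith [B.U.δ_pos]

/-- `X₃ ⊆ {F₁ ≥ 0}` (the generic part lies outside `X₁`, and above `c > a` one has
`F₁ ≥ s = f - a > 0`). [folklore] -/
theorem F₁_nonneg_of_mem_X₃ {y : X} (hy : y ∈ T.X₃) : 0 ≤ T.D.F₁ y := by
  rcases hy with hcl | hge
  · refine closure_lt_subset_le continuous_const T.D.continuous_F₁ (closure_mono (fun z hz => ?_) hcl)
    exact not_le.1 (fun h => hz.1 (T.D.mem_sector_iff.2 h))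
  · have hge : T.c ≤ B.f y := hge
    have h1 := T.band_le_c
    have h2 := B.U.δ_pos
    have h3 : B.f y = B.a + B.sFun y := B.f_eq_add_sFun y
    have hθ := T.D.θ_nonneg y
    have hκ := T.D.κ_pos
    show 0 ≤ B.sFun y + T.D.κ * T.D.θ y
    nlinarith

/-- A point of `X₂` on `∂X₁ ∖ F` has `r < 0`. [cite: GayKirby2016, Def. 1 and Fig. 1] -/
theorem rFun_neg_of_mem_X₂ (hc2 : B.a + B.U.δ + 2 * T.ε ≤ T.c) {p : X} (hp : p ∈ T.X₂) (h0 : T.D.F₁ p = 0)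
    (hps : p ∉ B.surface) : B.rFun p < 0 := by
  have hpU : p ∈ B.U.band := T.D.mem_band_of_F₁_eq_zero h0
  have hM : T.M p ≤ 0 := T.M_nonpos_of_mem_X₂ (B.hit_of_mem_band hpU) hp
  have hr : B.rFun p ≤ 0 := (T.M_nonpos_iff_of_mem_band hc2 hpU).1 hM
  exact lt_of_le_of_ne hr (T.D.rFun_ne_zero_of_F₁_eq_zero h0 hps)

/-- A point of `X₃` on `∂X₁ ∖ F` has `r > 0`. [cite: GayKirby2016, Def. 1 and Fig. 1] -/
theorem rFun_pos_of_mem_X₃ (hc2 : B.a + B.U.δ + 2 * T.ε ≤ T.c) {p : X} (hp : p ∈ T.X₃) (h0 : T.D.F₁ p = 0)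
    (hps : p ∉ B.surface) : 0 < B.rFun p := by
  have hpU : p ∈ B.U.band := T.D.mem_band_of_F₁_eq_zero h0
  have hM : 0 ≤ T.M p := T.M_nonneg_of_mem_X₃ (B.hit_of_mem_band hpU) hp
  have hr : 0 ≤ B.rFun p := by
    by_contra h
    have := (T.M_neg_iff_of_mem_band hc2 hpU).2 (not_le.1 h)
    linarith
  exact lt_of_le_of_ne hr (Ne.symm (T.D.rFun_ne_zero_of_F₁_eq_zero h0 hps))

/-- Flowing a point of `∂X₁` with `r ≠ 0` forwards takes it strictly outside `X₁`:
`Ft σ (fl y t) > 0` for small `t > 0`. [cite: GayKirby2016, §4, Lemma 14] -/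
theorem eventually_F₁_fl_pos {σ : ℝ} (hσ : σ = 1 ∨ σ = -1) {y : X} (hy : y ∈ B.posSet σ)
    (h0 : T.D.F₁ y = 0) : ∀ᶠ t in 𝓝[>] (0 : ℝ), B.U.fl y t ∈ B.posSet σ ∧ 0 < T.D.F₁ (B.U.fl y t) := by
  have hs : |B.sFun y| < T.D.χ₁.rIn := T.D.abs_sFun_lt_rIn_of_F₁_eq_zero h0
  have hd := T.D.hasDerivAt_Ft_comp_fl (σ := σ) hs
  have hF0 : T.D.Ft σ (B.U.fl y 0) = 0 := by
    rw [B.U.fl_zero, T.D.Ft_eq_F₁ (sign_mul_eq_abs hσ hy.2), h0]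
  have h1 := eventually_pos_of_hasDerivAt hd hF0
  have h2 : ∀ᶠ t in 𝓝[>] (0 : ℝ), B.U.fl y t ∈ B.posSet σ := B.tendsto_fl y ((B.isOpen_posSet σ).mem_nhds hy)
  filter_upwards [h1, h2] with t ht1 ht2
  refine ⟨ht2, ?_⟩
  rw [← T.D.Ft_eq_F₁ (sign_mul_eq_abs hσ ht2.2)]
  exact ht1

/-- **On the band with `r < 0`, `X₂ = {F₁ ≥ 0}`** — across `∂X₁ ∖ F`, `X₂` is the closure of
the complement of `X₁`. [cite: GayKirby2016, Def. 1 and Fig. 1] -/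
theorem mem_X₂_iff_of_mem_posSet (hc2 : B.a + B.U.δ + 2 * T.ε ≤ T.c) {y : X} (hy : y ∈ B.posSet (-1)) :
    y ∈ T.X₂ ↔ 0 ≤ T.D.F₁ y := by
  have hyU : y ∈ B.U.band := hy.1
  have hr : B.rFun y < 0 := by have h' : 0 < (-1) * B.rFun y := hy.2; linarith
  have hh : B.Hit y := B.hit_of_mem_band hyU
  refine ⟨T.F₁_nonneg_of_mem_X₂, fun h1 => ?_⟩
  rcases h1.lt_or_eq with hlt | heq
  · have hy₁ : y ∉ T.X₁ := fun h => absurd (T.D.mem_sector_iff.1 h) (not_le.2 hlt)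
    exact (T.mem_X₂_iff_of_hit hh hy₁).2 ((T.M_neg_iff_of_mem_band hc2 hyU).2 hr).le
  · -- `F₁ y = 0`: flow forwards into `S₂`
    apply T.closure_S₂_subset_X₂
    apply mem_closure_of_tendsto (B.tendsto_fl y)
    filter_upwards [T.eventually_F₁_fl_pos (Or.inr rfl) hy heq.symm] with t ht
    obtain ⟨hpos, hF⟩ := ht
    have htU : B.U.fl y t ∈ B.U.band := hpos.1
    have hrt : B.rFun (B.U.fl y t) < 0 := by have h' : 0 < (-1) * B.rFun (B.U.fl y t) := hpos.2; linarith
    have hMt : T.M (B.U.fl y t) < 0 := (T.M_neg_iff_of_mem_band hc2 htU).2 hrt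
    refine ⟨fun h => absurd (T.D.mem_sector_iff.1 h) (not_le.2 hF), ?_, B.hit_fl hh t, hMt⟩
    linarith [T.sub_le_M (B.U.fl y t)]

/-- **On the band with `r > 0`, `X₃ = {F₁ ≥ 0}`.** [cite: GayKirby2016, Def. 1 and Fig. 1] -/
theorem mem_X₃_iff_of_mem_posSet (hc2 : B.a + B.U.δ + 2 * T.ε ≤ T.c) {y : X} (hy : y ∈ B.posSet 1) :
    y ∈ T.X₃ ↔ 0 ≤ T.D.F₁ y := by
  have hyU : y ∈ B.U.band := hy.1
  have hr : 0 < B.rFun y := by have h' : 0 < 1 * B.rFun y := hy.2; linarith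
  have hh : B.Hit y := B.hit_of_mem_band hyU
  refine ⟨fun h => T.F₁_nonneg_of_mem_X₃ h, fun h1 => ?_⟩
  rcases h1.lt_or_eq with hlt | heq
  · have hy₁ : y ∉ T.X₁ := fun h => absurd (T.D.mem_sector_iff.1 h) (not_le.2 hlt)
    exact (T.mem_X₃_iff_of_hit hh hy₁).2 ((T.M_pos_iff_of_mem_band hc2 hyU).2 hr).le
  · left
    apply mem_closure_of_tendsto (B.tendsto_fl y)
    filter_upwards [T.eventually_F₁_fl_pos (Or.inl rfl) hy heq.symm] with t ht
    obtain ⟨hpos, hF⟩ := ht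
    have htU : B.U.fl y t ∈ B.U.band := hpos.1
    have hrt : 0 < B.rFun (B.U.fl y t) := by have h' : 0 < 1 * B.rFun (B.U.fl y t) := hpos.2; linarith
    exact ⟨fun h => absurd (T.D.mem_sector_iff.1 h) (not_le.2 hF), B.hit_fl hh t,
      (T.M_pos_iff_of_mem_band hc2 htU).2 hrt⟩

/-- **The half-slice chart of `X₂` at a point of `∂X₁ ∖ F`** (`r < 0`): the straightening chart
of `-Ft (-1)` (so that `X₂ = {Ft ≥ 0}` is the half-space), read on `posSet (-1)`.
[cite: GayKirby2016, Def. 1 and Fig. 1; Milnor1963, Thm. 3.1] -/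
def edgeChart₂ (hc2 : B.a + B.U.δ + 2 * T.ε ≤ T.c) {p : X} (h0 : T.D.F₁ p = 0) : HalfSliceChart (𝓡 4) T.X₂ :=
  (Classical.choose (exists_halfSliceChart_of_not_isMCriticalPt' (T.D.contMDiff_Ft (-1)).neg 0
    (not_isMCriticalPt_neg (T.D.not_isMCriticalPt_Ft (-1) (T.D.abs_sFun_lt_rIn_of_F₁_eq_zero h0))))).restrCongr
    (B.posSet (-1)) (B.isOpen_posSet _)
    (fun q hq => by
      rw [T.mem_X₂_iff_of_mem_posSet hc2 hq, mem_preimage, mem_Iic, neg_nonpos,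
        T.D.Ft_eq_F₁ (sign_mul_eq_abs (Or.inr rfl) hq.2)])

/-- The point lies in the source of its chart. [folklore] -/
theorem mem_edgeChart₂_source (hc2 : B.a + B.U.δ + 2 * T.ε ≤ T.c) {p : X} (h0 : T.D.F₁ p = 0)
    (hr : B.rFun p < 0) : p ∈ (T.edgeChart₂ hc2 h0).Θ.source :=
  ⟨(Classical.choose_spec (exists_halfSliceChart_of_not_isMCriticalPt' (T.D.contMDiff_Ft (-1)).neg 0
    (not_isMCriticalPt_neg (T.D.not_isMCriticalPt_Ft (-1) (T.D.abs_sFun_lt_rIn_of_F₁_eq_zero h0))))).1,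
    ⟨T.D.mem_band_of_F₁_eq_zero h0, by show 0 < (-1) * B.rFun p; linarith⟩⟩

/-- The source of the chart avoids the surface. [folklore] -/
theorem not_mem_surface_of_mem_edgeChart₂_source (hc2 : B.a + B.U.δ + 2 * T.ε ≤ T.c) {p : X}
    (h0 : T.D.F₁ p = 0) {q : X} (hq : q ∈ (T.edgeChart₂ hc2 h0).Θ.source) : q ∉ B.surface :=
  B.not_mem_surface_of_mem_posSet hq.2

/-- **The half-slice chart of `X₃` at a point of `∂X₁ ∖ F`** (`r > 0`). [cite: GayKirby2016, Def. 1 and Fig. 1; Milnor1963, Thm. 3.1] -/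
def edgeChart₃ (hc2 : B.a + B.U.δ + 2 * T.ε ≤ T.c) {p : X} (h0 : T.D.F₁ p = 0) : HalfSliceChart (𝓡 4) T.X₃ :=
  (Classical.choose (exists_halfSliceChart_of_not_isMCriticalPt' (T.D.contMDiff_Ft 1).neg 0
    (not_isMCriticalPt_neg (T.D.not_isMCriticalPt_Ft 1 (T.D.abs_sFun_lt_rIn_of_F₁_eq_zero h0))))).restrCongr
    (B.posSet 1) (B.isOpen_posSet _)
    (fun q hq => by
      rw [T.mem_X₃_iff_of_mem_posSet hc2 hq, mem_preimage, mem_Iic, neg_nonpos,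
        T.D.Ft_eq_F₁ (sign_mul_eq_abs (Or.inl rfl) hq.2)])

/-- The point lies in the source of its chart. [folklore] -/
theorem mem_edgeChart₃_source (hc2 : B.a + B.U.δ + 2 * T.ε ≤ T.c) {p : X} (h0 : T.D.F₁ p = 0)
    (hr : 0 < B.rFun p) : p ∈ (T.edgeChart₃ hc2 h0).Θ.source :=
  ⟨(Classical.choose_spec (exists_halfSliceChart_of_not_isMCriticalPt' (T.D.contMDiff_Ft 1).neg 0
    (not_isMCriticalPt_neg (T.D.not_isMCriticalPt_Ft 1 (T.D.abs_sFun_lt_rIn_of_F₁_eq_zero h0))))).1,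
    ⟨T.D.mem_band_of_F₁_eq_zero h0, by show 0 < 1 * B.rFun p; linarith⟩⟩

/-- The source of the chart avoids the surface. [folklore] -/
theorem not_mem_surface_of_mem_edgeChart₃_source (hc2 : B.a + B.U.δ + 2 * T.ε ≤ T.c) {p : X}
    (h0 : T.D.F₁ p = 0) {q : X} (hq : q ∈ (T.edgeChart₃ hc2 h0).Θ.source) : q ∉ B.surface :=
  B.not_mem_surface_of_mem_posSet hq.2

end TriData

/-! ### Interior charts -/

/-- **The chart at an interior point of a sector**: a translated chart of `X` with positive
`0`-th coordinate, restricted to the interior of the sector off the surface. [folklore] -/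
def interiorChart (S : Set X) (p : X) : HalfSliceChart (𝓡 4) S :=
  (sublevelChartLT' 3 (fun _ : X => (-1 : ℝ)) 0 continuous_const p).restrCongr (interior S ∩ B.surfaceᶜ)
    (isOpen_interior.inter B.isClosed_surface.isOpen_compl)
    (fun q hq => ⟨fun _ => by show (-1 : ℝ) ≤ 0; norm_num, fun _ => interior_subset hq.1⟩)

/-- An interior point off the surface lies in the source of its chart. [folklore] -/
theorem mem_interiorChart_source {S : Set X} {p : X} (hp : S ∈ 𝓝 p) (hps : p ∉ B.surface) :
    p ∈ (B.interiorChart S p).Θ.source :=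
  ⟨mem_sublevelChartLT'_source_self (by norm_num), ⟨mem_interior_iff_mem_nhds.2 hp, hps⟩⟩

/-- The source of an interior chart avoids the surface. [folklore] -/
theorem not_mem_surface_of_mem_interiorChart_source {S : Set X} {p q : X}
    (hq : q ∈ (B.interiorChart S p).Θ.source) : q ∉ B.surface := hq.2.2

namespace TriData

variable {B} (T : B.TriData)

/-- A point which hits, outside `X₁`, with `M < 0`, is interior to `X₂`. [cite: GayKirby2016, §4, Lemma 14] -/
theorem X₂_mem_nhds_of_M_neg {p : X} (hp : B.Hit p) (hp₁ : p ∉ T.X₁) (hM : T.M p < 0) : T.X₂ ∈ 𝓝 p := by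
  have h1 : ∀ᶠ y in 𝓝 p, y ∉ T.X₁ := T.isClosed_X₁.isOpen_compl.mem_nhds hp₁
  have h2 : ∀ᶠ y in 𝓝 p, B.Hit y := T.Fr.isOpen_setOf_hit.mem_nhds hp
  have h3 : ∀ᶠ y in 𝓝 p, T.M y < 0 := (T.continuousAt_M hp).eventually (Iio_mem_nhds hM)
  filter_upwards [h1, h2, h3] with y hy1 hy2 hy3
  exact T.S₂_subset_X₂ ⟨hy1, by linarith [T.sub_le_M y], hy2, hy3⟩

/-- A point which hits, outside `X₁`, with `M > 0`, is interior to `X₃`. [cite: GayKirby2016, §4, Lemma 14] -/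
theorem X₃_mem_nhds_of_M_pos {p : X} (hp : B.Hit p) (hp₁ : p ∉ T.X₁) (hM : 0 < T.M p) : T.X₃ ∈ 𝓝 p := by
  have h1 : ∀ᶠ y in 𝓝 p, y ∉ T.X₁ := T.isClosed_X₁.isOpen_compl.mem_nhds hp₁
  have h2 : ∀ᶠ y in 𝓝 p, B.Hit y := T.Fr.isOpen_setOf_hit.mem_nhds hp
  have h3 : ∀ᶠ y in 𝓝 p, 0 < T.M y := (T.continuousAt_M hp).eventually (Ioi_mem_nhds hM)
  filter_upwards [h1, h2, h3] with y hy1 hy2 hy3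
  exact T.S₃_subset_X₃ ⟨hy1, hy2, hy3⟩

/-- A point above `c` is interior to `X₃`. [folklore] -/
theorem X₃_mem_nhds_of_lt {p : X} (hp : T.c < B.f p) : T.X₃ ∈ 𝓝 p := by
  filter_upwards [(isOpen_lt continuous_const B.U.contMDiff_f.continuous).mem_nhds hp] with y hy
  exact T.mem_X₃_of_le (le_of_lt hy)


/-! ### The corner-slice atlases of `X₂` and `X₃` -/

/-- A point of `X₂` with `F₁ ≠ 0` lies outside `X₁`. [folklore] -/
theorem not_mem_X₁_of_mem_X₂ {p : X} (hp : p ∈ T.X₂) (h0 : T.D.F₁ p ≠ 0) : p ∉ T.X₁ := fun h =>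
  h0 (le_antisymm (T.D.mem_sector_iff.1 h) (T.F₁_nonneg_of_mem_X₂ hp))

/-- A point of `X₃` with `F₁ ≠ 0` lies outside `X₁`. [folklore] -/
theorem not_mem_X₁_of_mem_X₃ {p : X} (hp : p ∈ T.X₃) (h0 : T.D.F₁ p ≠ 0) : p ∉ T.X₁ := fun h =>
  h0 (le_antisymm (T.D.mem_sector_iff.1 h) (T.F₁_nonneg_of_mem_X₃ hp))

/-- A point of `X₂` outside `X₁` which does not hit lies on a sheet. [folklore] -/
theorem mem_sheets_of_mem_X₂ {p : X} (hp : p ∈ T.X₂) (hp₁ : p ∉ T.X₁) (hh : ¬ B.Hit p) : p ∈ T.sheets :=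
  ⟨T.a_le_of_not_mem_X₁_of_not_hit hp₁ hh, T.f_le_c_of_mem_X₂ hp, hh⟩

section Atlas

variable (hc2 : B.a + B.U.δ + 2 * T.ε ≤ T.c) {η : ℝ} (hη : 2 * T.ε ≤ η)
  (hL : ∀ q : X, IsMCriticalPt (𝓡 4) B.f q → B.a < B.f q → B.f q ≤ T.c →
    ∀ y : B.Y, RegularLevel.incl B.hf y ∈ stableSet (𝓡 4) B.U.ξ q → B.g y < B.b - η)

omit [T2Space X] [CompactSpace X] in
include hη in
/-- `ε < η`. [folklore] -/
theorem ε_lt_η : T.ε < η := by linarith [T.ε_pos]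

open Classical in
/-- **The sector `X₂` with its angle along `F` straightened, as data**: corner-slice charts at
the points of `F` (the wedge charts of `frame₂`); half-slice charts elsewhere — along
`∂X₁ ∖ F` the straightening charts of `Ft`, along the rounded interface `{M = 0}` those of the
straightening function of `M`, at the sheet tops those of `f`, and translated interior charts
at interior points (generic points with `M < 0` and the sheets below `c`, which are interior by
the `λ`-lemma). [cite: GayKirby2016, Def. 1 and §4, Lemma 14] -/
def cornerSliceAtlas₂ : CornerSliceAtlas T.X₂ B.surface (B.uFun T.frame₂) (B.vFun T.frame₂) B.π where
  halfDatum p hp :=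
    if h0 : T.D.F₁ p.1 = 0 then T.edgeChart₂ hc2 h0
    else if hh : B.Hit p.1 then
      (if hM : T.M p.1 = 0 then T.hitChart₂ hh hM else B.interiorChart T.X₂ p.1)
    else if hc : B.f p.1 = T.c then
      T.topChart₂ hη hL (T.mem_sheets_of_mem_X₂ p.2 (T.not_mem_X₁_of_mem_X₂ p.2 h0) hh)
        (T.not_mem_X₁_of_mem_X₂ p.2 h0) hc
    else B.interiorChart T.X₂ p.1
  half_mem_source p hp := by
    by_cases h0 : T.D.F₁ p.1 = 0
    · rw [dif_pos h0]
      exact T.mem_edgeChart₂_source hc2 h0 (T.rFun_neg_of_mem_X₂ hc2 p.2 h0 hp)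
    · rw [dif_neg h0]
      have hp₁ : p.1 ∉ T.X₁ := T.not_mem_X₁_of_mem_X₂ p.2 h0
      by_cases hh : B.Hit p.1
      · rw [dif_pos hh]
        by_cases hM : T.M p.1 = 0
        · rw [dif_pos hM]; exact T.mem_hitChart₂_source hh hM hp₁
        · rw [dif_neg hM]
          exact B.mem_interiorChart_source
            (T.X₂_mem_nhds_of_M_neg hh hp₁ (lt_of_le_of_ne (T.M_nonpos_of_mem_X₂ hh p.2) hM)) hp
      · rw [dif_neg hh]
        by_cases hc : B.f p.1 = T.c
        · rw [dif_pos hc]; exact T.mem_topChart₂_source hη hL _ _ hc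
        · rw [dif_neg hc]
          exact B.mem_interiorChart_source
            (T.X₂_mem_nhds_of_mem_sheets (T.ε_lt_η hη) hL (T.mem_sheets_of_mem_X₂ p.2 hp₁ hh) hp₁
              (lt_of_le_of_ne (T.f_le_c_of_mem_X₂ p.2) hc)).1 hp
  half_not_mem p hp q hq := by
    by_cases h0 : T.D.F₁ p.1 = 0
    · rw [dif_pos h0] at hq; exact T.not_mem_surface_of_mem_edgeChart₂_source hc2 h0 hq
    · rw [dif_neg h0] at hq
      by_cases hh : B.Hit p.1
      · rw [dif_pos hh] at hq
        by_cases hM : T.M p.1 = 0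
        · rw [dif_pos hM] at hq; exact T.not_mem_surface_of_mem_hitChart₂_source hh hM hq
        · rw [dif_neg hM] at hq; exact B.not_mem_surface_of_mem_interiorChart_source hq
      · rw [dif_neg hh] at hq
        by_cases hc : B.f p.1 = T.c
        · rw [dif_pos hc] at hq; exact T.not_mem_surface_of_mem_topChart₂_source hη hL _ _ hc hq
        · rw [dif_neg hc] at hq; exact B.not_mem_surface_of_mem_interiorChart_source hq
  cornerDatum p _ := T.cornerSliceChart₂ p.1
  corner_mem_source p hp := T.mem_cornerSliceChart₂_source (B.mem_box_of_mem_surface T.D.εw_pos hp)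

open Classical in
/-- **The sector `X₃` with its angle along `F` straightened, as data.** [cite: GayKirby2016, Def. 1 and §4, Lemma 14] -/
def cornerSliceAtlas₃ : CornerSliceAtlas T.X₃ B.surface (B.uFun T.frame₃) (B.vFun T.frame₃) B.π where
  halfDatum p hp :=
    if h0 : T.D.F₁ p.1 = 0 then T.edgeChart₃ hc2 h0
    else if hh : B.Hit p.1 then
      (if hM : T.M p.1 = 0 then T.hitChart₃ hh hM else B.interiorChart T.X₃ p.1)
    else if hc : B.f p.1 = T.c then
      T.topChart₃ hη hL ⟨by rw [hc]; linarith [T.band_le_c, B.U.δ_pos], le_of_eq hc, hh⟩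
        (T.not_mem_X₁_of_mem_X₃ p.2 h0) hc
    else B.interiorChart T.X₃ p.1
  half_mem_source p hp := by
    by_cases h0 : T.D.F₁ p.1 = 0
    · rw [dif_pos h0]
      exact T.mem_edgeChart₃_source hc2 h0 (T.rFun_pos_of_mem_X₃ hc2 p.2 h0 hp)
    · rw [dif_neg h0]
      have hp₁ : p.1 ∉ T.X₁ := T.not_mem_X₁_of_mem_X₃ p.2 h0
      by_cases hh : B.Hit p.1
      · rw [dif_pos hh]
        by_cases hM : T.M p.1 = 0
        · rw [dif_pos hM]; exact T.mem_hitChart₃_source hh hM hp₁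
        · rw [dif_neg hM]
          exact B.mem_interiorChart_source
            (T.X₃_mem_nhds_of_M_pos hh hp₁ (lt_of_le_of_ne (T.M_nonneg_of_mem_X₃ hh p.2) (Ne.symm hM))) hp
      · rw [dif_neg hh]
        by_cases hc : B.f p.1 = T.c
        · rw [dif_pos hc]; exact T.mem_topChart₃_source hη hL _ _ hc
        · rw [dif_neg hc]
          -- `f p > c` (the case `f p < c` would put `p` on a sheet below `c`, off `X₃`)
          apply B.mem_interiorChart_source _ hp
          rcases lt_or_gt_of_ne hc with hlt | hgt
          · have hsh : p.1 ∈ T.sheets := ⟨T.a_le_of_not_mem_X₁_of_not_hit hp₁ hh, hlt.le, hh⟩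
            have h := (T.X₂_mem_nhds_of_mem_sheets (T.ε_lt_η hη) hL hsh hp₁ hlt).2.self_of_nhds
            exact absurd p.2 h
          · exact T.X₃_mem_nhds_of_lt hgt
  half_not_mem p hp q hq := by
    by_cases h0 : T.D.F₁ p.1 = 0
    · rw [dif_pos h0] at hq; exact T.not_mem_surface_of_mem_edgeChart₃_source hc2 h0 hq
    · rw [dif_neg h0] at hq
      by_cases hh : B.Hit p.1
      · rw [dif_pos hh] at hq
        by_cases hM : T.M p.1 = 0
        · rw [dif_pos hM] at hq; exact T.not_mem_surface_of_mem_hitChart₃_source hh hM hq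
        · rw [dif_neg hM] at hq; exact B.not_mem_surface_of_mem_interiorChart_source hq
      · rw [dif_neg hh] at hq
        by_cases hc : B.f p.1 = T.c
        · rw [dif_pos hc] at hq; exact T.not_mem_surface_of_mem_topChart₃_source hη hL _ _ hc hq
        · rw [dif_neg hc] at hq; exact B.not_mem_surface_of_mem_interiorChart_source hq
  cornerDatum p _ := T.cornerSliceChart₃ p.1
  corner_mem_source p hp := T.mem_cornerSliceChart₃_source (B.mem_box_of_mem_surface T.D.εw_pos hp)

/-- **The sector `X₂` with its angle along `F` straightened satisfies the smooth items of clause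
(ii) of `Literature.Topology.FourManifolds.IsGKTrisection`**: a `C^∞` manifold with boundary
modelled on `𝓡∂ 4`, its inclusion a topological embedding onto `X₂`, a `C^∞` immersion off `F`,
with corner charts (`IsCornerAt`) at the points of `F`, which are boundary points.
[cite: GayKirby2016, Def. 1 and §4, Lemma 14] -/
theorem sector_smooth_clause₂ :
    letI := (T.cornerSliceAtlas₂ hc2 hη hL).chartedSpace
    IsManifold (𝓡∂ 4) ∞ T.X₂ ∧ Topology.IsEmbedding (Subtype.val : T.X₂ → X) ∧
      range (Subtype.val : T.X₂ → X) = T.X₂ ∧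
      (∀ w : T.X₂, w.1 ∉ B.surface → Manifold.IsImmersionAt (𝓡∂ 4) (𝓡 4) ∞ (Subtype.val : T.X₂ → X) w) ∧
      (∀ w : T.X₂, w.1 ∈ B.surface → IsCornerAt (Subtype.val : T.X₂ → X) w) ∧
      (∀ w : T.X₂, w.1 ∈ B.surface → w ∈ (𝓡∂ 4).boundary T.X₂) :=
  (T.cornerSliceAtlas₂ hc2 hη hL).sector_smooth_clause

/-- **The sector `X₃` with its angle along `F` straightened satisfies the smooth items of clause
(ii) of `Literature.Topology.FourManifolds.IsGKTrisection`.** [cite: GayKirby2016, Def. 1 and §4, Lemma 14] -/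
theorem sector_smooth_clause₃ :
    letI := (T.cornerSliceAtlas₃ hc2 hη hL).chartedSpace
    IsManifold (𝓡∂ 4) ∞ T.X₃ ∧ Topology.IsEmbedding (Subtype.val : T.X₃ → X) ∧
      range (Subtype.val : T.X₃ → X) = T.X₃ ∧
      (∀ w : T.X₃, w.1 ∉ B.surface → Manifold.IsImmersionAt (𝓡∂ 4) (𝓡 4) ∞ (Subtype.val : T.X₃ → X) w) ∧
      (∀ w : T.X₃, w.1 ∈ B.surface → IsCornerAt (Subtype.val : T.X₃ → X) w) ∧
      (∀ w : T.X₃, w.1 ∈ B.surface → w ∈ (𝓡∂ 4).boundary T.X₃) :=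
  (T.cornerSliceAtlas₃ hc2 hη hL).sector_smooth_clause

/-- `X₂` is compact. [folklore] -/
theorem compactSpace_X₂ : CompactSpace T.X₂ := isCompact_iff_compactSpace.1 T.isClosed_X₂.isCompact

/-- `X₃` is compact. [folklore] -/
theorem compactSpace_X₃ : CompactSpace T.X₃ := isCompact_iff_compactSpace.1 T.isClosed_X₃.isCompact


/-! ### The boundary of the straightened middle sectors, and the mutual intersections -/

omit [T2Space X] [CompactSpace X] [IsManifold (𝓡 4) ∞ X] in
/-- In a restricted chart the values are those of the original chart. [folklore] -/
theorem _root_.Literature.Topology.FourManifolds.HalfSliceChart.restrCongr_apply {S S' : Set X}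
    (D : HalfSliceChart (𝓡 4) S') (U : Set X) (hU : IsOpen U) (h : ∀ q ∈ U, q ∈ S ↔ q ∈ S') (q : X) :
    (D.restrCongr U hU h).Θ q = D.Θ q := rfl

/-- The `0`-th coordinate of the edge chart of `X₂` is `Ft (-1)`. [cite: Milnor1963, Thm. 3.1] -/
theorem edgeChart₂_apply_zero {p : X} (h0 : T.D.F₁ p = 0) {q : X} (hq : q ∈ (T.edgeChart₂ hc2 h0).Θ.source) :
    (T.edgeChart₂ hc2 h0).Θ q 0 = T.D.Ft (-1) q := by
  have h := (Classical.choose_spec (exists_halfSliceChart_of_not_isMCriticalPt' (T.D.contMDiff_Ft (-1)).neg 0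
    (not_isMCriticalPt_neg (T.D.not_isMCriticalPt_Ft (-1) (T.D.abs_sFun_lt_rIn_of_F₁_eq_zero h0))))).2 q hq.1
  rw [zero_sub, neg_neg] at h
  exact h

/-- The `0`-th coordinate of the edge chart of `X₃` is `Ft 1`. [cite: Milnor1963, Thm. 3.1] -/
theorem edgeChart₃_apply_zero {p : X} (h0 : T.D.F₁ p = 0) {q : X} (hq : q ∈ (T.edgeChart₃ hc2 h0).Θ.source) :
    (T.edgeChart₃ hc2 h0).Θ q 0 = T.D.Ft 1 q := by
  have h := (Classical.choose_spec (exists_halfSliceChart_of_not_isMCriticalPt' (T.D.contMDiff_Ft 1).neg 0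
    (not_isMCriticalPt_neg (T.D.not_isMCriticalPt_Ft 1 (T.D.abs_sFun_lt_rIn_of_F₁_eq_zero h0))))).2 q hq.1
  rw [zero_sub, neg_neg] at h
  exact h

/-- The `0`-th coordinate of the chart of `X₂` at a boundary point which hits is `-strFun`. [cite: Milnor1963, Thm. 3.1] -/
theorem hitChart₂_apply_zero {p : X} (hp : B.Hit p) (h0 : T.M p = 0) {q : X} (hq : q ∈ (T.hitChart₂ hp h0).Θ.source) :
    (T.hitChart₂ hp h0).Θ q 0 = -T.strFun hp h0 q := by
  have h := (Classical.choose_spec (exists_halfSliceChart_of_not_isMCriticalPt' (T.contMDiff_strFun hp h0) 0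
    (T.not_isMCriticalPt_strFun hp h0))).2 q hq.1
  rw [zero_sub] at h
  exact h

/-- The `0`-th coordinate of the chart of `X₃` at a boundary point which hits is `strFun`. [cite: Milnor1963, Thm. 3.1] -/
theorem hitChart₃_apply_zero {p : X} (hp : B.Hit p) (h0 : T.M p = 0) {q : X} (hq : q ∈ (T.hitChart₃ hp h0).Θ.source) :
    (T.hitChart₃ hp h0).Θ q 0 = T.strFun hp h0 q := by
  have h := (Classical.choose_spec (exists_halfSliceChart_of_not_isMCriticalPt' ((T.contMDiff_strFun hp h0).neg) 0
    (T.not_isMCriticalPt_neg_strFun hp h0))).2 q hq.1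
  rw [zero_sub, neg_neg] at h
  exact h

/-- The `0`-th coordinate of the top chart of `X₂` is `c - f`. [cite: Milnor1963, Thm. 3.1] -/
theorem topChart₂_apply_zero {p : X} (hp : p ∈ T.sheets) (hp₁ : p ∉ T.X₁) (hpc : B.f p = T.c) {q : X}
    (hq : q ∈ (T.topChart₂ hη hL hp hp₁ hpc).Θ.source) :
    (T.topChart₂ hη hL hp hp₁ hpc).Θ q 0 = T.c - B.f q :=
  (Classical.choose_spec (exists_halfSliceChart_of_not_isMCriticalPt' B.U.contMDiff_f T.c
    (T.regular_c p hpc))).2 q hq.1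

/-- The `0`-th coordinate of the top chart of `X₃` is `f - c`. [cite: Milnor1963, Thm. 3.1] -/
theorem topChart₃_apply_zero {p : X} (hp : p ∈ T.sheets) (hp₁ : p ∉ T.X₁) (hpc : B.f p = T.c) {q : X}
    (hq : q ∈ (T.topChart₃ hη hL hp hp₁ hpc).Θ.source) :
    (T.topChart₃ hη hL hp hp₁ hpc).Θ q 0 = B.f q - T.c := by
  have h : (T.topChart₃ hη hL hp hp₁ hpc).Θ q 0 = -T.c - -B.f q :=
    (Classical.choose_spec (exists_halfSliceChart_of_not_isMCriticalPt' B.U.contMDiff_f.neg (-T.c)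
      (not_isMCriticalPt_neg (T.regular_c p hpc)))).2 q hq.1
  rw [h]
  ring

/-- The `0`-th coordinate of an interior chart is positive. [folklore] -/
theorem _root_.Literature.Topology.FourManifolds.BiCollar.interiorChart_apply_zero_pos {S : Set X} {p q : X}
    (hq : q ∈ (B.interiorChart S p).Θ.source) : 0 < (B.interiorChart S p).Θ q 0 :=
  sublevelChartLT'_apply_zero_pos (k := 3) hq.1

/-- **The boundary points of the straightened `X₂`** are the points of `F`, of `∂X₁`, of the
rounded interface `{M = 0}` (points which hit) and of the tops of the sheets.
[cite: GayKirby2016, Def. 1 and §4, Lemma 14] -/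
theorem isBoundaryPoint_iff₂ (p : T.X₂) :
    letI := (T.cornerSliceAtlas₂ hc2 hη hL).chartedSpace
    (𝓡∂ 4).IsBoundaryPoint p ↔ p.1 ∈ B.surface ∨ T.D.F₁ p.1 = 0 ∨
      (B.Hit p.1 ∧ T.M p.1 = 0) ∨ (¬ B.Hit p.1 ∧ B.f p.1 = T.c) := by
  letI := (T.cornerSliceAtlas₂ hc2 hη hL).chartedSpace
  by_cases hps : p.1 ∈ B.surface
  · exact ⟨fun _ => Or.inl hps, fun _ => (T.cornerSliceAtlas₂ hc2 hη hL).isBoundaryPoint_of_mem p hps⟩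
  rw [(T.cornerSliceAtlas₂ hc2 hη hL).isBoundaryPoint_iff_of_not_mem p hps]
  show ((T.cornerSliceAtlas₂ hc2 hη hL).halfDatum p hps).Θ p.1 0 = 0 ↔ _
  simp only [cornerSliceAtlas₂]
  by_cases h0 : T.D.F₁ p.1 = 0
  · rw [dif_pos h0, T.edgeChart₂_apply_zero hc2 h0 (T.mem_edgeChart₂_source hc2 h0 (T.rFun_neg_of_mem_X₂ hc2 p.2 h0 hps)),
      T.D.Ft_eq_F₁ (sign_mul_eq_abs (Or.inr rfl) (by
        have := T.rFun_neg_of_mem_X₂ hc2 p.2 h0 hps; show 0 < (-1) * B.rFun p.1; linarith)), h0]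
    simp
  · rw [dif_neg h0]
    have hp₁ : p.1 ∉ T.X₁ := T.not_mem_X₁_of_mem_X₂ p.2 h0
    by_cases hh : B.Hit p.1
    · rw [dif_pos hh]
      by_cases hM : T.M p.1 = 0
      · rw [dif_pos hM, T.hitChart₂_apply_zero hh hM (T.mem_hitChart₂_source hh hM hp₁), neg_eq_zero,
          (T.strFun_eventuallyEq hh hM).self_of_nhds, hM]
        simp [hps, h0, hh]
      · rw [dif_neg hM]
        have hpos := B.interiorChart_apply_zero_pos (B.mem_interiorChart_source
          (T.X₂_mem_nhds_of_M_neg hh hp₁ (lt_of_le_of_ne (T.M_nonpos_of_mem_X₂ hh p.2) hM)) hps)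
        constructor
        · intro h; exact absurd h (ne_of_gt hpos)
        · rintro (h | h | h | h)
          · exact absurd h hps
          · exact absurd h h0
          · exact absurd h.2 hM
          · exact absurd hh h.1
    · rw [dif_neg hh]
      by_cases hc : B.f p.1 = T.c
      · rw [dif_pos hc, T.topChart₂_apply_zero hη hL _ _ hc (T.mem_topChart₂_source hη hL _ _ hc), hc, sub_self]
        simp [hh]
      · rw [dif_neg hc]
        have hpos := B.interiorChart_apply_zero_pos (B.mem_interiorChart_source
          (T.X₂_mem_nhds_of_mem_sheets (T.ε_lt_η hη) hL (T.mem_sheets_of_mem_X₂ p.2 hp₁ hh) hp₁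
            (lt_of_le_of_ne (T.f_le_c_of_mem_X₂ p.2) hc)).1 hps)
        constructor
        · intro h; exact absurd h (ne_of_gt hpos)
        · rintro (h | h | h | h)
          · exact absurd h hps
          · exact absurd h h0
          · exact absurd h.1 hh
          · exact absurd h.2 hc

/-- **The boundary points of the straightened `X₃`.** [cite: GayKirby2016, Def. 1 and §4, Lemma 14] -/
theorem isBoundaryPoint_iff₃ (p : T.X₃) :
    letI := (T.cornerSliceAtlas₃ hc2 hη hL).chartedSpace
    (𝓡∂ 4).IsBoundaryPoint p ↔ p.1 ∈ B.surface ∨ T.D.F₁ p.1 = 0 ∨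
      (B.Hit p.1 ∧ T.M p.1 = 0) ∨ (¬ B.Hit p.1 ∧ B.f p.1 = T.c) := by
  letI := (T.cornerSliceAtlas₃ hc2 hη hL).chartedSpace
  by_cases hps : p.1 ∈ B.surface
  · exact ⟨fun _ => Or.inl hps, fun _ => (T.cornerSliceAtlas₃ hc2 hη hL).isBoundaryPoint_of_mem p hps⟩
  rw [(T.cornerSliceAtlas₃ hc2 hη hL).isBoundaryPoint_iff_of_not_mem p hps]
  show ((T.cornerSliceAtlas₃ hc2 hη hL).halfDatum p hps).Θ p.1 0 = 0 ↔ _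
  simp only [cornerSliceAtlas₃]
  by_cases h0 : T.D.F₁ p.1 = 0
  · rw [dif_pos h0, T.edgeChart₃_apply_zero hc2 h0 (T.mem_edgeChart₃_source hc2 h0 (T.rFun_pos_of_mem_X₃ hc2 p.2 h0 hps)),
      T.D.Ft_eq_F₁ (sign_mul_eq_abs (Or.inl rfl) (by
        have := T.rFun_pos_of_mem_X₃ hc2 p.2 h0 hps; show 0 < 1 * B.rFun p.1; linarith)), h0]
    simp
  · rw [dif_neg h0]
    have hp₁ : p.1 ∉ T.X₁ := T.not_mem_X₁_of_mem_X₃ p.2 h0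
    by_cases hh : B.Hit p.1
    · rw [dif_pos hh]
      by_cases hM : T.M p.1 = 0
      · rw [dif_pos hM, T.hitChart₃_apply_zero hh hM (T.mem_hitChart₃_source hh hM hp₁),
          (T.strFun_eventuallyEq hh hM).self_of_nhds, hM]
        simp [hps, h0, hh]
      · rw [dif_neg hM]
        have hpos := B.interiorChart_apply_zero_pos (B.mem_interiorChart_source
          (T.X₃_mem_nhds_of_M_pos hh hp₁ (lt_of_le_of_ne (T.M_nonneg_of_mem_X₃ hh p.2) (Ne.symm hM))) hps)
        constructor
        · intro h; exact absurd h (ne_of_gt hpos)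
        · rintro (h | h | h | h)
          · exact absurd h hps
          · exact absurd h h0
          · exact absurd h.2 hM
          · exact absurd hh h.1
    · rw [dif_neg hh]
      by_cases hc : B.f p.1 = T.c
      · rw [dif_pos hc, T.topChart₃_apply_zero hη hL _ _ hc (T.mem_topChart₃_source hη hL _ _ hc), hc, sub_self]
        simp [hh]
      · rw [dif_neg hc]
        have hX₃ : T.X₃ ∈ 𝓝 p.1 := by
          rcases lt_or_gt_of_ne hc with hlt | hgt
          · have hsh : p.1 ∈ T.sheets := ⟨T.a_le_of_not_mem_X₁_of_not_hit hp₁ hh, hlt.le, hh⟩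
            exact absurd p.2 (T.X₂_mem_nhds_of_mem_sheets (T.ε_lt_η hη) hL hsh hp₁ hlt).2.self_of_nhds
          · exact T.X₃_mem_nhds_of_lt hgt
        have hpos := B.interiorChart_apply_zero_pos (B.mem_interiorChart_source hX₃ hps)
        constructor
        · intro h; exact absurd h (ne_of_gt hpos)
        · rintro (h | h | h | h)
          · exact absurd h hps
          · exact absurd h h0
          · exact absurd h.1 hh
          · exact absurd h.2 hc

/-- `X₁ ∩ X₂ ⊆ {F₁ = 0}`. [cite: GayKirby2016, Def. 1] -/
theorem F₁_eq_zero_of_mem_X₁_X₂ {x : X} (h1 : x ∈ T.X₁) (h2 : x ∈ T.X₂) : T.D.F₁ x = 0 :=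
  le_antisymm (T.D.mem_sector_iff.1 h1) (T.F₁_nonneg_of_mem_X₂ h2)

/-- `X₁ ∩ X₃ ⊆ {F₁ = 0}`. [cite: GayKirby2016, Def. 1] -/
theorem F₁_eq_zero_of_mem_X₁_X₃ {x : X} (h1 : x ∈ T.X₁) (h3 : x ∈ T.X₃) : T.D.F₁ x = 0 :=
  le_antisymm (T.D.mem_sector_iff.1 h1) (T.F₁_nonneg_of_mem_X₃ h3)

include hη hL in
/-- A point of `X₂ ∩ X₃` outside `X₁` and off `F` is on the rounded interface (if it hits) or at
the top of a sheet (if not). [cite: GayKirby2016, §4, Lemma 14] -/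
theorem interface_of_mem_X₂_X₃ {x : X} (h2 : x ∈ T.X₂) (h3 : x ∈ T.X₃) (hx₁ : x ∉ T.X₁) :
    (B.Hit x ∧ T.M x = 0) ∨ (¬ B.Hit x ∧ B.f x = T.c) := by
  by_cases hh : B.Hit x
  · exact Or.inl ⟨hh, le_antisymm (T.M_nonpos_of_mem_X₂ hh h2) (T.M_nonneg_of_mem_X₃ hh h3)⟩
  · right
    refine ⟨hh, ?_⟩
    have hsh := T.mem_sheets_of_mem_X₂ h2 hx₁ hh
    rcases hsh.2.1.lt_or_eq with hlt | heq
    · exact absurd h3 (T.X₂_mem_nhds_of_mem_sheets (T.ε_lt_η hη) hL hsh hx₁ hlt).2.self_of_nhds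
    · exact heq

/-- **`X₂ ∩ X₁` and `X₂ ∩ X₃` lie in the image of the boundary of the straightened `X₂`**
(clause (ii) of `IsGKTrisection` for `X₂`). [cite: GayKirby2016, Def. 1] -/
theorem inter_subset_image_boundary₂ :
    letI := (T.cornerSliceAtlas₂ hc2 hη hL).chartedSpace
    T.X₂ ∩ T.X₁ ⊆ (Subtype.val : T.X₂ → X) '' (𝓡∂ 4).boundary T.X₂ ∧
      T.X₂ ∩ T.X₃ ⊆ (Subtype.val : T.X₂ → X) '' (𝓡∂ 4).boundary T.X₂ := by
  letI := (T.cornerSliceAtlas₂ hc2 hη hL).chartedSpace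
  constructor
  · rintro x ⟨h2, h1⟩
    exact ⟨⟨x, h2⟩, (T.isBoundaryPoint_iff₂ hc2 hη hL ⟨x, h2⟩).2 (Or.inr (Or.inl (T.F₁_eq_zero_of_mem_X₁_X₂ h1 h2))), rfl⟩
  · rintro x ⟨h2, h3⟩
    refine ⟨⟨x, h2⟩, (T.isBoundaryPoint_iff₂ hc2 hη hL ⟨x, h2⟩).2 ?_, rfl⟩
    by_cases hx₁ : x ∈ T.X₁
    · exact Or.inr (Or.inl (T.F₁_eq_zero_of_mem_X₁_X₂ hx₁ h2))
    · exact Or.inr (Or.inr (T.interface_of_mem_X₂_X₃ hη hL h2 h3 hx₁))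

/-- **`X₃ ∩ X₁` and `X₃ ∩ X₂` lie in the image of the boundary of the straightened `X₃`.**
[cite: GayKirby2016, Def. 1] -/
theorem inter_subset_image_boundary₃ :
    letI := (T.cornerSliceAtlas₃ hc2 hη hL).chartedSpace
    T.X₃ ∩ T.X₁ ⊆ (Subtype.val : T.X₃ → X) '' (𝓡∂ 4).boundary T.X₃ ∧
      T.X₃ ∩ T.X₂ ⊆ (Subtype.val : T.X₃ → X) '' (𝓡∂ 4).boundary T.X₃ := by
  letI := (T.cornerSliceAtlas₃ hc2 hη hL).chartedSpace
  constructor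
  · rintro x ⟨h3, h1⟩
    exact ⟨⟨x, h3⟩, (T.isBoundaryPoint_iff₃ hc2 hη hL ⟨x, h3⟩).2 (Or.inr (Or.inl (T.F₁_eq_zero_of_mem_X₁_X₃ h1 h3))), rfl⟩
  · rintro x ⟨h3, h2⟩
    refine ⟨⟨x, h3⟩, (T.isBoundaryPoint_iff₃ hc2 hη hL ⟨x, h3⟩).2 ?_, rfl⟩
    by_cases hx₁ : x ∈ T.X₁
    · exact Or.inr (Or.inl (T.F₁_eq_zero_of_mem_X₁_X₃ hx₁ h3))
    · exact Or.inr (Or.inr (T.interface_of_mem_X₂_X₃ hη hL h2 h3 hx₁))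

/-- **`X₁ ∩ X₂` and `X₁ ∩ X₃` lie in the image of the boundary of the straightened `X₁`**
(`BevelData.mem_image_boundary_of_F₁_eq_zero`). [cite: GayKirby2016, Def. 1] -/
theorem inter_subset_image_boundary₁ :
    letI := T.D.cornerSliceAtlas.chartedSpace
    T.X₁ ∩ T.X₂ ⊆ (Subtype.val : T.D.sector → X) '' (𝓡∂ 4).boundary T.D.sector ∧
      T.X₁ ∩ T.X₃ ⊆ (Subtype.val : T.D.sector → X) '' (𝓡∂ 4).boundary T.D.sector := by
  letI := T.D.cornerSliceAtlas.chartedSpace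
  exact ⟨fun x hx => T.D.mem_image_boundary_of_F₁_eq_zero hx.1 (T.F₁_eq_zero_of_mem_X₁_X₂ hx.1 hx.2),
    fun x hx => T.D.mem_image_boundary_of_F₁_eq_zero hx.1 (T.F₁_eq_zero_of_mem_X₁_X₃ hx.1 hx.2)⟩

end Atlas

end TriData

end BiCollar

end Literature.Topology.FourManifolds

end
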